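import Summits.BirchSwinnertonDyer.Rank1Residual.Iwasawa.LocalTowerKernelAtPGoodOrdinary
import HarnessLib

/-!
# At an ANOMALOUS good ordinary prime, `Gal(ℚ̄_p/ℚ_p)` fixes the reductions of all `p`-torsion
# points: `Ẽ[p] ⊆ Ẽ(𝔽_p)` (cell `b2b-bsdres`, unit `b2b-bsdres-eisenstein-p1`, gen 16; V79 step 1)

HONEST FRAMING (run/shared/lean/b2b/bsd-rank1-residual/, verbatim in every file): the goal of the
cell is to DELETE the COMBINATION-SHAPED residual classes of the Birch–Swinnerton-Dyer formula for
ALL analytic-rank `≤ 1` elliptic curves over `ℚ` — "full BSD formula for every rank `≤ 1` curve in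
class `C`" assembled STRICTLY from published theorems — so that the rank-`≤ 1` remainder becomes
exactly the CONSTRUCTION-SHAPED classes, which are TYPED (missing-input `Prop`s), NOT attempted.
This is not "finishing BSD". Sub-cell `b2b-bsdres-eisenstein-p1`: research route; NO CLAIM BEYOND
STATED CLASSES; nothing here changes a label; nothing is booked. THEOREMS ONLY (no `def`, no named
fact, nothing asserted).

What. `E/ℚ` globally minimal, `p ∤ Δ_E` (good), `p ∤ a_p` (ordinary), `p ∣ #Ẽ(𝔽_p)` (ANOMALOUS,
`a_p ≡ 1 mod p`), `v ∋ p`, `red_v : E(K̄_v) → Ẽ(k̄_w)` the tree's reduction map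
(`X2.GreenbergVatsalReductionDatum.localRed`). Then

* `exists_localRed_frob_smul_eq_of_anomalous` — some `P₀ ∈ E(K̄_v)[p]` with `red P₀ ≠ Õ` has
  `red (τP₀) = red P₀` for an arithmetic Frobenius `τ`: Cauchy gives `R₀ ∈ Ẽ(𝔽_p)` of order `p`;
  its image `R ∈ Ẽ(k_w)` lifts to `P₀ ∈ E[p]` (the ordinary filtration `red : E[p] ↠ Ẽ[p]`,
  `localRed_ordinary_filtration`); the coordinates of `red P₀` lie in `𝔽_p`, so the Frobenius
  congruence `τ z ≡ z^p (mod 𝔪_w)` (`exists_residueMap`) gives `τ x ≡ x`, `τ y ≡ y (mod 𝔪_w)` and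
  `reducePoint_congrEquiv_smul_eq_of_val` concludes — the converse of the tree's non-anomalous
  `exists_mem_localSubgroup_localRed_smul_sub_ne_zero` (`Iwasawa/LocalTowerKernelAtPGoodOrdinary`);
* `localRed_frob_smul_eq_of_anomalous` — hence `red (τP) = red P` for EVERY `P ∈ E(K̄_v)[p]`:
  the subgroup `{P ∈ E[p] : red (τP) = red P}` contains the kernel line `E[p] ∩ ker red` (order `p`,
  `τ`-stable) and `P₀ ∉` it, so has order `> p` dividing `#E[p] = p²`;
* `localRed_smul_eq_of_anomalous` — and `red (σP) = red P` for EVERY `σ ∈ Gal(K̄_v/ℚ_v)`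
  (`σ = τⁿ · ι · u`, `ι` inertial — `localRed_smul_of_mem_absInertia` —, `u` in the open stabiliser
  of `P`: `exists_eq_frobenius_pow_mul_inertia_mul`). Equivalently: at an anomalous prime the
  decomposition group acts TRIVIALLY on `Ẽ[p] = red(E[p])`, i.e. `Ẽ[p] ⊆ Ẽ(𝔽_p)`
  (Mazur 1972 §5 "anomalous primes"; Greenberg LNM 1716 §3, p. 89: the factor `#Ẽ(𝔽_p)(p)`).

References: [GreenbergLNM1716] §2 p. 70, §3 Lemma 3.4 (p. 89); [Mazur1972] §5 (anomalous primes);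
[SilvermanAEC2009] VII.2.1, III.6.4; [NeukirchANT1999] II (9.9); X1R0-GAPMAP §24.5 (V79, CLAIM 1).
-/

set_option autoImplicit false

noncomputable section

open scoped Classical NNReal

universe u

open NumberField IsDedekindDomain Field IsDedekindDomain.HeightOneSpectrum WeierstrassCurve
open Literature.NumberTheory.EllipticCurves Literature.NumberTheory.GaloisRepresentations
  Literature.NumberTheory.EllipticCurves.FormalGroupChart
  Summit.BirchSwinnertonDyer.Rank1Residual.X2.GreenbergVatsalReductionDatum
  Summit.BirchSwinnertonDyer.Rank1Residual.Additive

namespace Summit.BirchSwinnertonDyer.Rank1Residual.X1.AnomalousReduction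

variable (W : WeierstrassCurve ℚ) [W.IsElliptic] [W.IsGloballyMinimal] (p : ℕ) [hp : Fact p.Prime]
  {v : HeightOneSpectrum (𝓞 ℚ)}

/-! ## §1 One Frobenius-fixed reduction of order `p` from anomaly -/

/-- **Anomaly gives a `p`-torsion point whose (non-zero) reduction is fixed by Frobenius.** At a
good ordinary `v ∋ p` with `p ∣ #Ẽ(𝔽_p)`: for an arithmetic Frobenius `τ ∈ Gal(K̄_v/ℚ_v)` at a prime
`𝔐` of `\bar 𝓞_v` there is `P₀ ∈ E(K̄_v)` with `pP₀ = 0`, `red P₀ ≠ Õ` and `red (τP₀) = red P₀`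
(a point of `Ẽ(𝔽_p)` of order `p`, Cauchy, lifted through `red : E[p] ↠ Ẽ[p]`; its coordinates are
in `𝔽_p`, hence fixed by `z ↦ z^p`). [cite: GreenbergLNM1716, §3 Lemma 3.4 (p. 89)]
[cite: Mazur1972, §5] -/
theorem exists_localRed_frob_smul_eq_of_anomalous (hpv : ((p : ℕ) : 𝓞 ℚ) ∈ v.asIdeal)
    (hΔ : ¬ (p : ℤ) ∣ minimalDiscriminantInt W) (hord : ¬ (p : ℤ) ∣ W.frobeniusTrace p)
    (hanom : p ∣ W.reductionPointCount p)
    {𝔐 : Ideal v.localAbsIntegers} (h𝔐 : 𝔐 ∈ v.localPrimesAbove)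
    {τ : absoluteGaloisGroup (v.adicCompletion ℚ)}
    (hτ : IsArithFrobAt (v.adicCompletionIntegers ℚ) τ 𝔐) :
    ∃ P₀ : localPoints W (v.adicCompletion ℚ), (p : ℤ) • P₀ = 0 ∧ localRed W p hpv hΔ P₀ ≠ 0 ∧
      localRed W p hpv hΔ (τ • P₀) = localRed W p hpv hΔ P₀ := by
  -- standard set-up of the ordinary files
  have hw := specVal_spec v
  have hvO : (specVal v).Integers (specVal v).valuationSubring :=
    Valuation.valuationSubring.integers (specVal v)
  have hΔu : IsUnit ((integralModelInt W).map (algebraMap ℤ ↥(specVal v).valuationSubring)).Δ :=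
    isUnit_Δ_localIntModel W hpv hw hΔ
  have hMK : ((integralModelInt W).map (algebraMap ℤ ↥(specVal v).valuationSubring)).baseChange
      (AlgebraicClosure (v.adicCompletion ℚ)) = W.baseChange (AlgebraicClosure (v.adicCompletion ℚ)) :=
    localIntModel_baseChange W (specVal v).valuationSubring
  haveI hV : (W.baseChange (AlgebraicClosure (v.adicCompletion ℚ))).IsIntegral (specVal v).integer :=
    ⟨⟨(integralModelInt W).map (algebraMap ℤ ↥(specVal v).integer),
      W.baseChange_eq_localIntModel_integer_baseChange⟩⟩
  obtain ⟨r, hr, -, hrF⟩ := exists_residueMap hw h𝔐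
  have hq : Nat.card (IsLocalRing.ResidueField (v.adicCompletionIntegers ℚ)) = p := by
    rw [natCard_residueField_adicCompletionIntegers v,
      Rat.HeightOneSpectrum.primesEquiv_eq_of_natCast_mem v hp.out hpv]
  haveI hcharw : CharP (IsLocalRing.ResidueField ((specVal v).valuationSubring)) p :=
    GoodModelLine.charP_residueField_specVal p hpv
  have hordA := W.exists_zsmul_eq_zero_localRed_ne_zero hw hΔu (localRed W p hpv hΔ)
    (localRed_apply W p hpv hΔ) hpv hΔ hord
  obtain ⟨-, hsurj, -⟩ := W.localRed_ordinary_filtration hΔu (localRed W p hpv hΔ)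
    (localRed_apply W p hpv hΔ) hordA
  -- (1) a point `R₀ ∈ Ẽ(𝔽_p)` of order `p` (Cauchy)
  haveI : NeZero p := ⟨hp.out.ne_zero⟩
  set Wp : WeierstrassCurve (ZMod p) := (integralModelInt W).map (Int.castRingHom (ZMod p)) with hWp
  obtain ⟨R₀, hR₀⟩ := exists_prime_addOrderOf_dvd_card' (G := Wp.toAffine.Point) p hanom
  obtain ⟨i, j, h₀, hR₀ij⟩ : ∃ i j h₀, R₀ = Affine.Point.some i j h₀ := by
    revert hR₀
    rcases R₀ with _ | ⟨i, j, h₀⟩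
    · intro h0
      rw [← Affine.Point.zero_def, addOrderOf_zero] at h0
      exact absurd h0.symm hp.out.one_lt.ne'
    · exact fun _ ↦ ⟨i, j, h₀, rfl⟩
  -- (2) its image `R ∈ Ẽ(k_w)`: `W_ℤ mod 𝔪_w = (W_ℤ mod p) ⊗ k_w`
  letI algw : Algebra (ZMod p) (IsLocalRing.ResidueField ((specVal v).valuationSubring)) :=
    ZMod.algebra _ p
  have hcurve : ((integralModelInt W).map (algebraMap ℤ ↥(specVal v).valuationSubring)).map
      (IsLocalRing.residue ((specVal v).valuationSubring)) =
      Wp.baseChange (IsLocalRing.ResidueField ((specVal v).valuationSubring)) := by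
    rw [hWp, WeierstrassCurve.map_map, WeierstrassCurve.baseChange, WeierstrassCurve.map_map]
    congr 1
    exact Subsingleton.elim _ _
  have e0 : Wp.baseChange (ZMod p) = Wp := by
    rw [WeierstrassCurve.baseChange, Algebra.algebraMap_self, WeierstrassCurve.map_id]
  set ι₀ : ZMod p →ₐ[ZMod p] IsLocalRing.ResidueField ((specVal v).valuationSubring) :=
    Algebra.ofId (ZMod p) _ with hι₀
  set R : (((integralModelInt W).map (algebraMap ℤ ↥(specVal v).valuationSubring)).map
      (IsLocalRing.residue ((specVal v).valuationSubring))).toAffine.Point :=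
    Affine.Point.congrEquiv hcurve.symm
      (Affine.Point.map (W' := Wp) ι₀ (Affine.Point.congrEquiv e0.symm R₀)) with hRdef
  have hRord : addOrderOf R = p := by
    rw [hRdef, AddEquiv.addOrderOf_eq, addOrderOf_injective _ (Affine.Point.map_injective _),
      AddEquiv.addOrderOf_eq, hR₀]
  have hRp : ((p ^ 1 : ℕ) : ℤ) • R = 0 := by
    rw [pow_one, natCast_zsmul, ← hRord, addOrderOf_nsmul_eq_zero]
  have hR0 : R ≠ 0 := by
    intro h
    rw [h, addOrderOf_zero] at hRord
    exact hp.out.one_lt.ne hRord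
  obtain ⟨hnsR, hRij⟩ : ∃ hns, R = Affine.Point.some (ι₀ i) (ι₀ j) hns :=
    ⟨_, by rw [hRdef, hR₀ij, Affine.Point.congrEquiv_some, Affine.Point.map_some,
      Affine.Point.congrEquiv_some]⟩
  -- (3) lift `R` to `P₀ ∈ E(K̄_v)[p]`, `P₀ = (x, y)` with `x` integral
  obtain ⟨P₀, hpP₀, hredP₀⟩ := hsurj 1 R hRp
  have hpP₀' : (p : ℤ) • P₀ = 0 := by rw [pow_one] at hpP₀; exact hpP₀
  have hredP₀0 : localRed W p hpv hΔ P₀ ≠ 0 := by rw [hredP₀]; exact hR0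
  obtain ⟨x, y, h, rfl⟩ : ∃ x y h, P₀ = Affine.Point.some x y h := by
    have hP0 : P₀ ≠ 0 := fun h0 ↦ hredP₀0 (by rw [h0, map_zero])
    revert hP0
    change ∀ _ : (show (W.baseChange (AlgebraicClosure (v.adicCompletion ℚ))).toAffine.Point from P₀) ≠ 0, _
    rcases P₀ with _ | ⟨x, y, h⟩
    · intro h0; exact absurd Affine.Point.zero_def h0.symm
    · intro; exact ⟨x, y, h, rfl⟩
  have hx : specVal v x ≤ 1 := by
    by_contra hx
    apply hredP₀0
    exact (W.localRed_eq_zero_iff_mem_kernel hΔu (localRed W p hpv hΔ) (localRed_apply W p hpv hΔ)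
      (Affine.Point.some x y h)).mpr ((some_mem_kernel_iff (w := specVal v) h).mpr (not_le.mp hx))
  obtain ⟨hy', hns', eR⟩ := reducePoint_congrEquiv_some_of_val_le_one hΔu hMK x y h hx
  -- the coordinates of `red P₀ = R` are `ι₀ i`, `ι₀ j`
  have hcoord : IsLocalRing.residue ((specVal v).valuationSubring) ⟨x, hx⟩ = ι₀ i ∧
      IsLocalRing.residue ((specVal v).valuationSubring) ⟨y, hy'⟩ = ι₀ j := by
    have e := hredP₀
    rw [localRed_apply, eR, hRij] at e
    simp only [Affine.Point.some.injEq] at e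
    exact e
  -- (4) `r` factors through the residue field of `𝒪_w`; `𝔽_p`-rational residues are Frobenius-fixed
  have hker : ∀ a ∈ IsLocalRing.maximalIdeal ((specVal v).valuationSubring), r a = 0 := by
    intro a ha
    rw [IsLocalRing.mem_maximalIdeal, mem_nonunits_iff, hvO.isUnit_iff_valuation_eq_one] at ha
    exact (hr a).mpr (lt_of_le_of_ne ((Valuation.mem_valuationSubring_iff (specVal v) _).mp a.2) ha)
  let rt : IsLocalRing.ResidueField ((specVal v).valuationSubring) →+*
      AlgebraicClosure (IsLocalRing.ResidueField (v.adicCompletionIntegers ℚ)) :=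
    Ideal.Quotient.lift (IsLocalRing.maximalIdeal ((specVal v).valuationSubring)) r hker
  have hrt : ∀ a, rt (IsLocalRing.residue ((specVal v).valuationSubring) a) = r a := fun a ↦
    Ideal.Quotient.lift_mk _ _ _
  have hmove : ∀ (z : AlgebraicClosure (v.adicCompletion ℚ)) (hz : specVal v z ≤ 1) (c : ZMod p),
      IsLocalRing.residue ((specVal v).valuationSubring) ⟨z, hz⟩ = ι₀ c →
        specVal v (τ • z - z) < 1 := by
    intro z hz c hzc
    have hτz : specVal v (τ • z) ≤ 1 := by rwa [spectralValuation_smul hw]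
    have e1 : r ⟨z, hz⟩ = rt (ι₀ c) := by rw [← hzc, hrt]; rfl
    have hfix : r ⟨z, hz⟩ ^ Nat.card (IsLocalRing.ResidueField (v.adicCompletionIntegers ℚ)) =
        r ⟨z, hz⟩ := by
      rw [hq, e1, ← map_pow, ← map_pow, ZMod.pow_card]
    have h1 : r (⟨τ • z, hτz⟩ - ⟨z, hz⟩) = 0 := by
      rw [map_sub, hrF hτ ⟨z, hz⟩ hτz, hfix, sub_self]
    exact (hr _).mp h1
  -- (5) conclude
  refine ⟨Affine.Point.some x y h, hpP₀', hredP₀0, ?_⟩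
  rw [localRed_apply, localRed_apply]
  refine reducePoint_congrEquiv_smul_eq_of_val hw hMK τ _ fun x' y' h' hP' ↦ ?_
  cases hP'
  exact ⟨fun hx'' ↦ hmove x hx'' i hcoord.1, fun hy'' ↦ hmove y hy'' j hcoord.2⟩


/-! ## §2 Frobenius fixes the reductions of ALL `p`-torsion points -/

/-- **At an anomalous good ordinary prime an arithmetic Frobenius fixes `red P` for EVERY
`P ∈ E(K̄_v)[p]`.** The subgroup `S = {P ∈ E[p] : red (τP) = red P}` contains the kernel line
`E[p] ∩ ker red = ⟨P₁⟩` (order `p`; `ker red` is `Γ`-stable, `localRed_smul_eq_zero_iff`) and the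
point `P₀ ∉ ⟨P₁⟩` of §1, so `p < #S ∣ #E[p] = p²` and `S = E[p]`: `Ẽ[p] = red(E[p])` is fixed by
Frobenius, i.e. `Ẽ[p] ⊆ Ẽ(𝔽_p)`. [cite: GreenbergLNM1716, §3 Lemma 3.4 (p. 89)] [cite: Mazur1972, §5]
[cite: SilvermanAEC2009, Cor. III.6.4(b)] -/
theorem localRed_frob_smul_eq_of_anomalous (hpv : ((p : ℕ) : 𝓞 ℚ) ∈ v.asIdeal)
    (hΔ : ¬ (p : ℤ) ∣ minimalDiscriminantInt W) (hord : ¬ (p : ℤ) ∣ W.frobeniusTrace p)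
    (hanom : p ∣ W.reductionPointCount p)
    {𝔐 : Ideal v.localAbsIntegers} (h𝔐 : 𝔐 ∈ v.localPrimesAbove)
    {τ : absoluteGaloisGroup (v.adicCompletion ℚ)}
    (hτ : IsArithFrobAt (v.adicCompletionIntegers ℚ) τ 𝔐)
    {P : localPoints W (v.adicCompletion ℚ)} (hP : (p : ℤ) • P = 0) :
    localRed W p hpv hΔ (τ • P) = localRed W p hpv hΔ P := by
  have hw := specVal_spec v
  have hΔu : IsUnit ((integralModelInt W).map (algebraMap ℤ ↥(specVal v).valuationSubring)).Δ :=
    isUnit_Δ_localIntModel W hpv hw hΔ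
  haveI hcharw : CharP (IsLocalRing.ResidueField ((specVal v).valuationSubring)) p :=
    GoodModelLine.charP_residueField_specVal p hpv
  have hordA := W.exists_zsmul_eq_zero_localRed_ne_zero hw hΔu (localRed W p hpv hΔ)
    (localRed_apply W p hpv hΔ) hpv hΔ hord
  obtain ⟨hker, -, -⟩ := W.localRed_ordinary_filtration hΔu (localRed W p hpv hΔ)
    (localRed_apply W p hpv hΔ) hordA
  obtain ⟨P₁, hP₁0, hP₁ord, hP₁gen⟩ := hker 1
  obtain ⟨P₀, hpP₀, hP₀0, hP₀τ⟩ :=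
    exists_localRed_frob_smul_eq_of_anomalous W p hpv hΔ hord hanom h𝔐 hτ
  -- `σ ∘ n = n ∘ σ` on `E(K̄_v)`
  have hzs : ∀ (σ : absoluteGaloisGroup (v.adicCompletion ℚ)) (n : ℤ)
      (Q : localPoints W (v.adicCompletion ℚ)), σ • (n • Q) = n • (σ • Q) := fun σ n Q ↦
    map_zsmul (DistribSMul.toAddMonoidHom (localPoints W (v.adicCompletion ℚ)) σ) n Q
  -- the finite group `T = E(K̄_v)[p]` of order `p²`
  -- (NB: no `CharZero K̄_v` instance here — it would re-route `Algebra ℚ K̄_v`.)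
  have hp0 : ((p : ℕ) : AlgebraicClosure (v.adicCompletion ℚ)) ≠ 0 := by
    rw [← map_natCast (algebraMap ℚ (AlgebraicClosure (v.adicCompletion ℚ)))]
    exact (map_ne_zero _).mpr (Nat.cast_ne_zero.mpr hp.out.ne_zero)
  set T : AddSubgroup (localPoints W (v.adicCompletion ℚ)) :=
    AddSubgroup.torsionBy (localPoints W (v.adicCompletion ℚ)) (p : ℤ) with hTdef
  have hmemT : ∀ Q : localPoints W (v.adicCompletion ℚ), Q ∈ T ↔ (p : ℤ) • Q = 0 := fun Q ↦
    Submodule.mem_torsionBy_iff (p : ℤ) Q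
  have hTcard : Nat.card T = p ^ 2 := by
    rw [← card_torsionPoints_eq_sq_holds W (AlgebraicClosure (v.adicCompletion ℚ)) hp0]
    exact Nat.card_congr
      { toFun := fun Q ↦ ⟨Q.1, (W.mem_torsionPoints_iff _ _).2 ((hmemT _).1 Q.2)⟩
        invFun := fun Q ↦ ⟨Q.1, (hmemT _).2 ((W.mem_torsionPoints_iff _ _).1 Q.2)⟩
        left_inv := fun _ ↦ rfl
        right_inv := fun _ ↦ rfl }
  haveI hTfin : Finite T := Nat.finite_of_card_ne_zero (by rw [hTcard]; exact pow_ne_zero 2 hp.out.ne_zero)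
  -- the subgroup `S ≤ T` where Frobenius fixes the reduction, as a kernel
  set f : localPoints W (v.adicCompletion ℚ) →+ _ :=
    (localRed W p hpv hΔ).comp (DistribSMul.toAddMonoidHom (localPoints W (v.adicCompletion ℚ)) τ) -
      localRed W p hpv hΔ with hfdef
  have hf : ∀ Q, f Q = localRed W p hpv hΔ (τ • Q) - localRed W p hpv hΔ Q := fun Q ↦ rfl
  set S : AddSubgroup T := (f.comp T.subtype).ker with hSdef
  have hmemS : ∀ Q : T, Q ∈ S ↔
      localRed W p hpv hΔ (τ • (Q : localPoints W (v.adicCompletion ℚ))) =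
        localRed W p hpv hΔ (Q : localPoints W (v.adicCompletion ℚ)) := fun Q ↦ by
    rw [hSdef, AddMonoidHom.mem_ker, AddMonoidHom.comp_apply, hf, sub_eq_zero]
    rfl
  -- `P₁, P₀ ∈ T`
  have hP₁T : P₁ ∈ T := (hmemT P₁).2 (by
    have h := addOrderOf_nsmul_eq_zero P₁
    rw [hP₁ord, pow_one] at h
    rw [natCast_zsmul]; exact h)
  have hP₀T : P₀ ∈ T := (hmemT P₀).2 hpP₀
  -- `K = ⟨P₁⟩ ≤ S`, of order `p`
  set K : AddSubgroup T := AddSubgroup.zmultiples (⟨P₁, hP₁T⟩ : T) with hKdef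
  have hKS : K ≤ S := by
    refine AddSubgroup.zmultiples_le_of_mem ((hmemS _).2 ?_)
    change localRed W p hpv hΔ (τ • P₁) = localRed W p hpv hΔ P₁
    rw [hP₁0, X2.GreenbergVatsalReductionDatum.localRed_smul_eq_zero_iff W p hpv hΔ τ P₁]
    exact hP₁0
  have hKcard : Nat.card K = p := by
    rw [hKdef, Nat.card_zmultiples, ← AddSubgroup.addOrderOf_coe]
    change addOrderOf P₁ = p
    rw [hP₁ord, pow_one]
  -- `P₀ ∈ S ∖ K`
  have hP₀S : (⟨P₀, hP₀T⟩ : T) ∈ S := (hmemS _).2 hP₀τ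
  have hP₀K : (⟨P₀, hP₀T⟩ : T) ∉ K := by
    intro hmem
    obtain ⟨k, hk⟩ := AddSubgroup.mem_zmultiples_iff.mp hmem
    have hk' : k • P₁ = P₀ := by
      have := congrArg Subtype.val hk
      simpa using this
    apply hP₀0
    rw [← hk', map_zsmul, hP₁0, zsmul_zero]
  -- `p ∣ #S ∣ p²` and `#S ≠ p`, so `S = T`
  have hSdvd : Nat.card S ∣ p ^ 2 := hTcard ▸ AddSubgroup.card_addSubgroup_dvd_card S
  have hpS : p ∣ Nat.card S := hKcard ▸ AddSubgroup.card_dvd_of_le hKS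
  obtain ⟨k, hk2, hSk⟩ := (Nat.dvd_prime_pow hp.out).1 hSdvd
  have hStop : S = ⊤ := by
    interval_cases k
    · exfalso
      rw [hSk, pow_zero, Nat.dvd_one] at hpS
      exact hp.out.one_lt.ne' hpS
    · exfalso
      have hKeq : K = S := AddSubgroup.eq_of_le_of_card_ge hKS (by rw [hSk, pow_one, hKcard])
      exact hP₀K (hKeq ▸ hP₀S)
    · exact AddSubgroup.eq_top_of_card_eq S (by rw [hSk, hTcard])
  -- conclude
  have hPS : (⟨P, (hmemT P).2 hP⟩ : T) ∈ S := hStop ▸ AddSubgroup.mem_top _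
  exact (hmemS _).1 hPS

/-! ## §3 The whole decomposition group fixes `Ẽ[p]` -/

/-- **At an ANOMALOUS good ordinary `v ∋ p`, `Gal(K̄_v/ℚ_v)` does not change the reduction of any
`p`-torsion point: `red (σP) = red P` for all `σ` and all `P ∈ E(K̄_v)[p]`** — the decomposition
group acts trivially on `Ẽ[p] = red(E[p])` ("`Ẽ[p] ⊆ Ẽ(𝔽_p)`"). From §2 by local Frobenius
generation `σ = τⁿ · ι · u` (`exists_eq_frobenius_pow_mul_inertia_mul`: `ι` in the inertia group,
which does not change reductions — `localRed_smul_of_mem_absInertia` —, `u` in the open stabiliser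
of `P`). The converse (non-anomalous ⇒ a Frobenius MOVES the ordinary point) is the tree's
`Iwasawa.GoodOrdinary.exists_mem_localSubgroup_localRed_smul_sub_ne_zero`.
[cite: GreenbergLNM1716, §3 Lemma 3.4 (p. 89)] [cite: Mazur1972, §5]
[cite: NeukirchANT1999, Ch. II §9 Prop. (9.9)–(9.11)] -/
theorem localRed_smul_eq_of_anomalous (hpv : ((p : ℕ) : 𝓞 ℚ) ∈ v.asIdeal)
    (hΔ : ¬ (p : ℤ) ∣ minimalDiscriminantInt W) (hord : ¬ (p : ℤ) ∣ W.frobeniusTrace p)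
    (hanom : p ∣ W.reductionPointCount p) (σ : absoluteGaloisGroup (v.adicCompletion ℚ))
    {P : localPoints W (v.adicCompletion ℚ)} (hP : (p : ℤ) • P = 0) :
    localRed W p hpv hΔ (σ • P) = localRed W p hpv hΔ P := by
  obtain ⟨𝔐, h𝔐⟩ := v.localPrimesAbove_nonempty
  obtain ⟨τ, hτ⟩ := exists_isArithFrobAt_localAbsIntegers (v := v) h𝔐
  have hzs : ∀ (σ : absoluteGaloisGroup (v.adicCompletion ℚ)) (n : ℤ)
      (Q : localPoints W (v.adicCompletion ℚ)), σ • (n • Q) = n • (σ • Q) := fun σ n Q ↦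
    map_zsmul (DistribSMul.toAddMonoidHom (localPoints W (v.adicCompletion ℚ)) σ) n Q
  -- Frobenius powers
  have hτn : ∀ (n : ℕ) (Q : localPoints W (v.adicCompletion ℚ)), (p : ℤ) • Q = 0 →
      localRed W p hpv hΔ (τ ^ n • Q) = localRed W p hpv hΔ Q := by
    intro n
    induction n with
    | zero => intro Q _; rw [pow_zero, one_smul]
    | succ n ih =>
      intro Q hQ
      rw [pow_succ, mul_smul, ih _ (by rw [← hzs, hQ, smul_zero]),
        localRed_frob_smul_eq_of_anomalous W p hpv hΔ hord hanom h𝔐 hτ hQ]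
  obtain ⟨n, ι, u, hι, hu, rfl⟩ := v.exists_eq_frobenius_pow_mul_inertia_mul h𝔐 hτ
    (W.isOpen_stabilizer_localPoints (v.adicCompletion ℚ) P) σ
  rw [IsDedekindDomain.HeightOneSpectrum.inertia_eq_absInertia (specVal_spec v) h𝔐] at hι
  rw [mul_smul, mul_smul, MulAction.mem_stabilizer_iff.mp hu,
    hτn n _ (by rw [← hzs, hP, smul_zero]), localRed_smul_of_mem_absInertia W p hpv hΔ hι]

end Summit.BirchSwinnertonDyer.Rank1Residual.X1.AnomalousReduction

end
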